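import Summits.Ventures.LatticeQCDFlow.Exactness.Phi4MetropolisPolyObs
import Summits.Ventures.LatticeQCDFlow.Exactness.Phi4MetropolisScanEnvelopeDCT
import HarnessLib

/-!
# The random-scan Metropolis operator is reversible and contracting on polynomial-envelope observables (step laws with moments)

HONEST FRAMING: exact (Metropolis-corrected) sampling algorithms for lattice gauge theory;
figures of merit are autocorrelation/cost numbers at stated couplings and volumes; no
continuum-physics claim.  (SCALAR calibration rung S0-A: not a gauge result.)

Venture `LatticeQCDFlow` (cell pub-lqcd), topic `Exactness`; FANOUT row 2 (`s0-phi4`, LOCAL arm,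
leftover (α″)).  NEW WORK of the cell, the companion of `Phi4MetropolisPolyObs` ((int), (stab), (lin) on
`PolyObs` for step laws with all moments): (symm) and (contr) follow from the BOUNDED case
(`metroScan_reversible`, `metroScan_contraction`) by clipping the observables at level `N` and
dominated convergence (`N → ∞`), exactly as gen-13's `Phi4MetropolisScanEnvelopeDCT` did for the
quadratic class on the window; the dominating functions are the polynomial envelopes
`B μ_{2k} env^k` of `abs_metroSite_le_poly`.  Nothing is cited as a fact.

## What is proved (coercive action; `ρ ≥ 0` measurable, `∫ρ = 1`, even, with all moments
`∫ (1+|u|)^j ρ < ∞`)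

* `clip_polyBound`, `abs_metroScan_le_poly`, `tendsto_metroSite_clip_poly`,
  `tendsto_metroScan_clip_poly`;
* **`metroScan_reversible_poly`** — `∫ (Kf) g e^{−S} = ∫ f (Kg) e^{−S}` for `f, g ∈ PolyObs`;
* **`metroScan_contraction_poly`** — `∫ (Kf)² e^{−S} ≤ ∫ f² e^{−S}` for `f ∈ PolyObs`.

With these, `PolyObs` is an admissible class for the random-site scan under any step law with moments;
the floor for the magnetisation itself is `Exactness/Phi4MetropolisMagnetisationMomentCSD.lean`.
-/

namespace Summit.Ventures.LatticeQCDFlow.Exactness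

open Real MeasureTheory Filter Finset Topology
open Summit.Ventures.LatticeQCDFlow.Scoring

section PolyDCT

variable {n : ℕ}

/-- The clipped observable keeps the polynomial envelope of the original (same constants). -/
theorem clip_polyBound {f : (Fin (n + 1) → ℝ) → ℝ} {B : ℝ} {k : ℕ}
    (hfb : ∀ φ, |f φ| ≤ B * (1 + ∑ w, φ w ^ 2) ^ k) (N : ℕ) (φ : Fin (n + 1) → ℝ) :
    |max (-(N : ℝ)) (min (N : ℝ) (f φ))| ≤ B * (1 + ∑ w, φ w ^ 2) ^ k :=
  (Literature.Analysis.FunctionSpaces.abs_clamp_le_abs (Nat.cast_nonneg N) (f φ)).trans (hfb φ)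

/-- Envelope bound for the scan with the SAME constants as the observable:
`|K f(φ)| ≤ B μ_{2k} env(φ)^k`. -/
theorem abs_metroScan_le_poly (J : Fin (n + 1) → Fin (n + 1) → ℝ) (lam : ℝ) {ρ : ℝ → ℝ}
    (hρ0 : ∀ u, 0 ≤ ρ u) (hρm : Measurable ρ) {k : ℕ}
    (hρk : Integrable (fun u => (1 + |u|) ^ (2 * k) * ρ u)) {f : (Fin (n + 1) → ℝ) → ℝ}
    (hfm : Measurable f) {B : ℝ} (hB : 0 ≤ B) (hfb : ∀ φ, |f φ| ≤ B * (1 + ∑ w, φ w ^ 2) ^ k)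
    (φ : Fin (n + 1) → ℝ) :
    |metroScan J lam ρ f φ| ≤ B * (∫ u, (1 + |u|) ^ (2 * k) * ρ u) * (1 + ∑ w, φ w ^ 2) ^ k := by
  have hn : (0 : ℝ) < (n : ℝ) + 1 := by positivity
  unfold metroScan
  rw [abs_div, abs_of_pos hn, div_le_iff₀ hn]
  calc |∑ x, metroSite J lam ρ x f φ| ≤ ∑ x, |metroSite J lam ρ x f φ| :=
        Finset.abs_sum_le_sum_abs _ _
    _ ≤ ∑ _x : Fin (n + 1), B * (∫ u, (1 + |u|) ^ (2 * k) * ρ u) * (1 + ∑ w, φ w ^ 2) ^ k :=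
        Finset.sum_le_sum fun x _ => abs_metroSite_le_poly J lam hρ0 hρm hρk x hfm hB hfb φ
    _ = B * (∫ u, (1 + |u|) ^ (2 * k) * ρ u) * (1 + ∑ w, φ w ^ 2) ^ k * ((n : ℝ) + 1) := by
        rw [Finset.sum_const, Finset.card_univ, Fintype.card_fin, nsmul_eq_mul]
        push_cast
        ring

/-- **Truncation under the hit**: `M_x(clip_N f)(φ) → M_x f(φ)` (dominated convergence in the proposal
variable; dominating function `B env(φ)^k (1+|t'−φ_x|)^{2k} ρ(t'−φ_x)`). -/
theorem tendsto_metroSite_clip_poly (J : Fin (n + 1) → Fin (n + 1) → ℝ) (lam : ℝ) {ρ : ℝ → ℝ}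
    (hρ0 : ∀ u, 0 ≤ ρ u) (hρm : Measurable ρ) {k : ℕ}
    (hρk : Integrable (fun u => (1 + |u|) ^ (2 * k) * ρ u)) (x : Fin (n + 1))
    {f : (Fin (n + 1) → ℝ) → ℝ} (hfm : Measurable f) {B : ℝ} (hB : 0 ≤ B)
    (hfb : ∀ φ, |f φ| ≤ B * (1 + ∑ w, φ w ^ 2) ^ k) (φ : Fin (n + 1) → ℝ) :
    Tendsto (fun N : ℕ => metroSite J lam ρ x (fun ψ => max (-(N : ℝ)) (min (N : ℝ) (f ψ))) φ)
      atTop (𝓝 (metroSite J lam ρ x f φ)) := by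
  unfold metroSite
  have hρt : Integrable (fun t' => (1 + |t' - φ x|) ^ (2 * k) * ρ (t' - φ x)) :=
    hρk.comp_sub_right (φ x)
  refine tendsto_integral_of_dominated_convergence
    (fun t' => B * (1 + ∑ w, φ w ^ 2) ^ k * ((1 + |t' - φ x|) ^ (2 * k) * ρ (t' - φ x)))
    (fun N => ?_) (hρt.const_mul _) (fun N => Eventually.of_forall fun t' => ?_)
    (Eventually.of_forall fun t' => ?_)
  · exact (integrable_metroSite_integrand_poly J lam hρ0 hρm hρk x
      (measurable_const.max (measurable_const.min hfm)) hB (clip_polyBound hfb N) φ).1.aestronglyMeasurable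
  · exact (integrable_metroSite_integrand_poly J lam hρ0 hρm hρk x
      (measurable_const.max (measurable_const.min hfm)) hB (clip_polyBound hfb N) φ).2 t'
  · exact (((tendsto_clip (f (Function.update φ x t'))).const_mul _).add
      ((tendsto_clip (f φ)).const_mul _)).mul_const _

/-- **Truncation under the scan**: `K(clip_N f)(φ) → K f(φ)`. -/
theorem tendsto_metroScan_clip_poly (J : Fin (n + 1) → Fin (n + 1) → ℝ) (lam : ℝ) {ρ : ℝ → ℝ}
    (hρ0 : ∀ u, 0 ≤ ρ u) (hρm : Measurable ρ) {k : ℕ}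
    (hρk : Integrable (fun u => (1 + |u|) ^ (2 * k) * ρ u)) {f : (Fin (n + 1) → ℝ) → ℝ}
    (hfm : Measurable f) {B : ℝ} (hB : 0 ≤ B) (hfb : ∀ φ, |f φ| ≤ B * (1 + ∑ w, φ w ^ 2) ^ k)
    (φ : Fin (n + 1) → ℝ) :
    Tendsto (fun N : ℕ => metroScan J lam ρ (fun ψ => max (-(N : ℝ)) (min (N : ℝ) (f ψ))) φ)
      atTop (𝓝 (metroScan J lam ρ f φ)) := by
  unfold metroScan
  exact (tendsto_finsetSum _ fun x _ =>
    tendsto_metroSite_clip_poly J lam hρ0 hρm hρk x hfm hB hfb φ).div_const _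

/-- **THE RANDOM-SITE SCAN IS REVERSIBLE ON `PolyObs`** (coercive action; even step density with all
moments): `∫ (Kf) g e^{−S} = ∫ f (Kg) e^{−S}` for `f, g ∈ PolyObs`. -/
theorem metroScan_reversible_poly {J : Fin (n + 1) → Fin (n + 1) → ℝ} {lam ε K : ℝ} (hε : 0 < ε)
    (hS : ∀ φ : Fin (n + 1) → ℝ, ε * ∑ w, φ w ^ 2 - K ≤ latticePhi4Action J lam φ)
    {ρ : ℝ → ℝ} (hρ0 : ∀ u, 0 ≤ ρ u) (hρm : Measurable ρ) (hρi : Integrable ρ)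
    (hρ1 : ∫ u, ρ u = 1) (hρs : ∀ u, ρ (-u) = ρ u)
    (hρmom : ∀ j : ℕ, Integrable (fun u => (1 + |u|) ^ j * ρ u))
    {f g : (Fin (n + 1) → ℝ) → ℝ} (hf : PolyObs f) (hg : PolyObs g) :
    ∫ φ, metroScan J lam ρ f φ * g φ * gibbsWeight J lam φ
      = ∫ φ, f φ * metroScan J lam ρ g φ * gibbsWeight J lam φ := by
  obtain ⟨hfm, Bf, kf, hfb0⟩ := hf
  obtain ⟨hgm, Bg, kg, hgb0⟩ := hg
  have hfb := abs_le_abs_mul_env hfb0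
  have hgb := abs_le_abs_mul_env hgb0
  have hBf : 0 ≤ |Bf| := abs_nonneg _
  have hBg : 0 ≤ |Bg| := abs_nonneg _
  set μf := ∫ u, (1 + |u|) ^ (2 * kf) * ρ u with hμf
  set μg := ∫ u, (1 + |u|) ^ (2 * kg) * ρ u with hμg
  have hEnv := integrable_env_pow_mul_gibbsWeight hε hS (kf + kg)
  have hwm : Measurable (gibbsWeight J lam) := (continuous_gibbsWeight J lam).measurable
  set fN : ℕ → (Fin (n + 1) → ℝ) → ℝ := fun N ψ => max (-(N : ℝ)) (min (N : ℝ) (f ψ)) with hfN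
  set gN : ℕ → (Fin (n + 1) → ℝ) → ℝ := fun N ψ => max (-(N : ℝ)) (min (N : ℝ) (g ψ)) with hgN
  have hfNb : ∀ N, BddObs (fN N) := fun N => bddObs_clip hfm N
  have hgNb : ∀ N, BddObs (gN N) := fun N => bddObs_clip hgm N
  have hN : ∀ N, ∫ φ, metroScan J lam ρ (fN N) φ * gN N φ * gibbsWeight J lam φ
      = ∫ φ, fN N φ * metroScan J lam ρ (gN N) φ * gibbsWeight J lam φ :=
    fun N => metroScan_reversible hε hS hρ0 hρm hρi hρ1 hρs (hfNb N) (hgNb N)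
  have hKfN : ∀ N φ, |metroScan J lam ρ (fN N) φ| ≤ |Bf| * μf * (1 + ∑ w, φ w ^ 2) ^ kf :=
    fun N φ => abs_metroScan_le_poly J lam hρ0 hρm (hρmom (2 * kf)) (hfNb N).1 hBf (clip_polyBound hfb N) φ
  have hKgN : ∀ N φ, |metroScan J lam ρ (gN N) φ| ≤ |Bg| * μg * (1 + ∑ w, φ w ^ 2) ^ kg :=
    fun N φ => abs_metroScan_le_poly J lam hρ0 hρm (hρmom (2 * kg)) (hgNb N).1 hBg (clip_polyBound hgb N) φ
  have hμf0 : 0 ≤ μf := integral_nonneg fun u => mul_nonneg (by positivity) (hρ0 u)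
  have hμg0 : 0 ≤ μg := integral_nonneg fun u => mul_nonneg (by positivity) (hρ0 u)
  have henv0 : ∀ (φ : Fin (n + 1) → ℝ) j, 0 ≤ (1 + ∑ w, φ w ^ 2) ^ j :=
    fun φ j => pow_nonneg (zero_le_one.trans (one_le_env φ)) _
  -- left-hand sides converge
  have hL : Tendsto (fun N => ∫ φ, metroScan J lam ρ (fN N) φ * gN N φ * gibbsWeight J lam φ)
      atTop (𝓝 (∫ φ, metroScan J lam ρ f φ * g φ * gibbsWeight J lam φ)) := by
    refine tendsto_integral_of_dominated_convergence
      (fun φ => |Bf| * μf * |Bg| * ((1 + ∑ w, φ w ^ 2) ^ (kf + kg) * gibbsWeight J lam φ))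
      (fun N => (((polyObs_metroScan J lam hρ0 hρm hρmom (polyObs_of_bddObs (hfNb N))).1.mul
        (hgNb N).1).mul hwm).aestronglyMeasurable)
      (hEnv.const_mul _) (fun N => Eventually.of_forall fun φ => ?_)
      (Eventually.of_forall fun φ => ?_)
    · have hw := gibbsWeight_pos J lam φ
      rw [Real.norm_eq_abs, abs_mul, abs_mul, abs_of_pos hw, pow_add]
      calc |metroScan J lam ρ (fN N) φ| * |gN N φ| * gibbsWeight J lam φ
          ≤ (|Bf| * μf * (1 + ∑ w, φ w ^ 2) ^ kf) * (|Bg| * (1 + ∑ w, φ w ^ 2) ^ kg)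
            * gibbsWeight J lam φ := by
            refine mul_le_mul_of_nonneg_right ?_ hw.le
            exact mul_le_mul (hKfN N φ) (clip_polyBound hgb N φ) (abs_nonneg _)
              (mul_nonneg (mul_nonneg hBf hμf0) (henv0 φ kf))
        _ = |Bf| * μf * |Bg| * ((1 + ∑ w, φ w ^ 2) ^ kf * (1 + ∑ w, φ w ^ 2) ^ kg
            * gibbsWeight J lam φ) := by ring
    · exact ((tendsto_metroScan_clip_poly J lam hρ0 hρm (hρmom (2 * kf)) hfm hBf hfb φ).mul
        (tendsto_clip (g φ))).mul_const _
  -- right-hand sides converge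
  have hR : Tendsto (fun N => ∫ φ, fN N φ * metroScan J lam ρ (gN N) φ * gibbsWeight J lam φ)
      atTop (𝓝 (∫ φ, f φ * metroScan J lam ρ g φ * gibbsWeight J lam φ)) := by
    refine tendsto_integral_of_dominated_convergence
      (fun φ => |Bf| * (|Bg| * μg) * ((1 + ∑ w, φ w ^ 2) ^ (kf + kg) * gibbsWeight J lam φ))
      (fun N => (((hfNb N).1.mul
        (polyObs_metroScan J lam hρ0 hρm hρmom (polyObs_of_bddObs (hgNb N))).1).mul hwm).aestronglyMeasurable)
      (hEnv.const_mul _) (fun N => Eventually.of_forall fun φ => ?_)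
      (Eventually.of_forall fun φ => ?_)
    · have hw := gibbsWeight_pos J lam φ
      rw [Real.norm_eq_abs, abs_mul, abs_mul, abs_of_pos hw, pow_add]
      calc |fN N φ| * |metroScan J lam ρ (gN N) φ| * gibbsWeight J lam φ
          ≤ (|Bf| * (1 + ∑ w, φ w ^ 2) ^ kf) * (|Bg| * μg * (1 + ∑ w, φ w ^ 2) ^ kg)
            * gibbsWeight J lam φ := by
            refine mul_le_mul_of_nonneg_right ?_ hw.le
            exact mul_le_mul (clip_polyBound hfb N φ) (hKgN N φ) (abs_nonneg _)
              (mul_nonneg hBf (henv0 φ kf))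
        _ = |Bf| * (|Bg| * μg) * ((1 + ∑ w, φ w ^ 2) ^ kf * (1 + ∑ w, φ w ^ 2) ^ kg
            * gibbsWeight J lam φ) := by ring
    · exact ((tendsto_clip (f φ)).mul
        (tendsto_metroScan_clip_poly J lam hρ0 hρm (hρmom (2 * kg)) hgm hBg hgb φ)).mul_const _
  have hL' : Tendsto (fun N => ∫ φ, metroScan J lam ρ (fN N) φ * gN N φ * gibbsWeight J lam φ)
      atTop (𝓝 (∫ φ, f φ * metroScan J lam ρ g φ * gibbsWeight J lam φ)) := by
    simp_rw [hN]
    exact hR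
  exact tendsto_nhds_unique hL hL'

/-- **THE RANDOM-SITE SCAN IS AN `L²(e^{−S})` CONTRACTION ON `PolyObs`** (coercive action; even step
density with all moments): `∫ (Kf)² e^{−S} ≤ ∫ f² e^{−S}`. -/
theorem metroScan_contraction_poly {J : Fin (n + 1) → Fin (n + 1) → ℝ} {lam ε K : ℝ} (hε : 0 < ε)
    (hS : ∀ φ : Fin (n + 1) → ℝ, ε * ∑ w, φ w ^ 2 - K ≤ latticePhi4Action J lam φ)
    {ρ : ℝ → ℝ} (hρ0 : ∀ u, 0 ≤ ρ u) (hρm : Measurable ρ) (hρi : Integrable ρ)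
    (hρ1 : ∫ u, ρ u = 1) (hρs : ∀ u, ρ (-u) = ρ u)
    (hρmom : ∀ j : ℕ, Integrable (fun u => (1 + |u|) ^ j * ρ u))
    {f : (Fin (n + 1) → ℝ) → ℝ} (hf : PolyObs f) :
    ∫ φ, metroScan J lam ρ f φ ^ 2 * gibbsWeight J lam φ ≤ ∫ φ, f φ ^ 2 * gibbsWeight J lam φ := by
  obtain ⟨hfm, Bf, kf, hfb0⟩ := hf
  have hfb := abs_le_abs_mul_env hfb0
  have hBf : 0 ≤ |Bf| := abs_nonneg _
  set μf := ∫ u, (1 + |u|) ^ (2 * kf) * ρ u with hμf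
  have hEnv := integrable_env_pow_mul_gibbsWeight hε hS (kf + kf)
  have hwm : Measurable (gibbsWeight J lam) := (continuous_gibbsWeight J lam).measurable
  set fN : ℕ → (Fin (n + 1) → ℝ) → ℝ := fun N ψ => max (-(N : ℝ)) (min (N : ℝ) (f ψ)) with hfN
  have hfNb : ∀ N, BddObs (fN N) := fun N => bddObs_clip hfm N
  have hN : ∀ N, ∫ φ, metroScan J lam ρ (fN N) φ ^ 2 * gibbsWeight J lam φ
      ≤ ∫ φ, fN N φ ^ 2 * gibbsWeight J lam φ :=
    fun N => metroScan_contraction hε hS hρ0 hρm hρi hρ1 hρs (hfNb N)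
  have hKfN : ∀ N φ, |metroScan J lam ρ (fN N) φ| ≤ |Bf| * μf * (1 + ∑ w, φ w ^ 2) ^ kf :=
    fun N φ => abs_metroScan_le_poly J lam hρ0 hρm (hρmom (2 * kf)) (hfNb N).1 hBf (clip_polyBound hfb N) φ
  have hL : Tendsto (fun N => ∫ φ, metroScan J lam ρ (fN N) φ ^ 2 * gibbsWeight J lam φ)
      atTop (𝓝 (∫ φ, metroScan J lam ρ f φ ^ 2 * gibbsWeight J lam φ)) := by
    refine tendsto_integral_of_dominated_convergence
      (fun φ => (|Bf| * μf) ^ 2 * ((1 + ∑ w, φ w ^ 2) ^ (kf + kf) * gibbsWeight J lam φ))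
      (fun N => (((polyObs_metroScan J lam hρ0 hρm hρmom (polyObs_of_bddObs (hfNb N))).1.pow_const 2).mul
        hwm).aestronglyMeasurable)
      (hEnv.const_mul _) (fun N => Eventually.of_forall fun φ => ?_)
      (Eventually.of_forall fun φ => ?_)
    · have hw := gibbsWeight_pos J lam φ
      rw [Real.norm_eq_abs, abs_mul, abs_of_pos hw, abs_pow, pow_add]
      calc |metroScan J lam ρ (fN N) φ| ^ 2 * gibbsWeight J lam φ
          ≤ (|Bf| * μf * (1 + ∑ w, φ w ^ 2) ^ kf) ^ 2 * gibbsWeight J lam φ :=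
            mul_le_mul_of_nonneg_right (pow_le_pow_left₀ (abs_nonneg _) (hKfN N φ) 2) hw.le
        _ = (|Bf| * μf) ^ 2 * ((1 + ∑ w, φ w ^ 2) ^ kf * (1 + ∑ w, φ w ^ 2) ^ kf
            * gibbsWeight J lam φ) := by ring
    · exact ((tendsto_metroScan_clip_poly J lam hρ0 hρm (hρmom (2 * kf)) hfm hBf hfb φ).pow 2).mul_const _
  have hR : Tendsto (fun N => ∫ φ, fN N φ ^ 2 * gibbsWeight J lam φ)
      atTop (𝓝 (∫ φ, f φ ^ 2 * gibbsWeight J lam φ)) := by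
    refine tendsto_integral_of_dominated_convergence
      (fun φ => |Bf| ^ 2 * ((1 + ∑ w, φ w ^ 2) ^ (kf + kf) * gibbsWeight J lam φ))
      (fun N => (((hfNb N).1.pow_const 2).mul hwm).aestronglyMeasurable)
      (hEnv.const_mul _) (fun N => Eventually.of_forall fun φ => ?_)
      (Eventually.of_forall fun φ => ?_)
    · have hw := gibbsWeight_pos J lam φ
      rw [Real.norm_eq_abs, abs_mul, abs_of_pos hw, abs_pow, pow_add]
      calc |fN N φ| ^ 2 * gibbsWeight J lam φ
          ≤ (|Bf| * (1 + ∑ w, φ w ^ 2) ^ kf) ^ 2 * gibbsWeight J lam φ :=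
            mul_le_mul_of_nonneg_right (pow_le_pow_left₀ (abs_nonneg _) (clip_polyBound hfb N φ) 2) hw.le
        _ = |Bf| ^ 2 * ((1 + ∑ w, φ w ^ 2) ^ kf * (1 + ∑ w, φ w ^ 2) ^ kf * gibbsWeight J lam φ) := by
            ring
    · exact ((tendsto_clip (f φ)).pow 2).mul_const _
  exact le_of_tendsto_of_tendsto' hL hR hN

end PolyDCT

end Summit.Ventures.LatticeQCDFlow.Exactness
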